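import Literature.RepresentationTheory.IntertwiningMapBaseChange
import Mathlib.Topology.Algebra.OpenSubgroup
import HarnessLib

/-!
# Fixed vectors under extension of scalars: finite-index and open stabilisers pass from `V` to `K ⊗_k V`

Topic `RepresentationTheory`; namespace `Literature.RepresentationTheory.IntertwiningBaseChange` (sequel of
`IntertwiningMapBaseChange`: `repBaseChange K ρ : Representation K G (K ⊗[k] V)`, `g ↦ 1 ⊗ ρ(g)`, `repBaseChange_apply`).
THEOREMS ONLY; no definition, no named fact, no instance, no `sorry`.

Let `k → K` be commutative rings, `G` a group and `ρ : G → GL(V)` a representation on a `k`-module.  If every vector of `V` is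
fixed by a subgroup of `G` of FINITE INDEX (resp. by an OPEN subgroup, for a topology on `G`), then so is every vector of the
extended representation `ρ_K = 1 ⊗ ρ` on `K ⊗_k V`: pure tensors `c ⊗ y` by the stabiliser of `y`, sums by the intersection of
two such subgroups (finite index, resp. open, is stable under `⊓`).
* `exists_finiteIndex_forall_repBaseChange_eq` — the finite-index form;
* `exists_isOpen_forall_repBaseChange_eq` — the open form («`K ⊗_k V` is smooth when `V` is»);
* `repBaseChange_eq_self_of_forall_eq_self` — an element acting trivially on `V` acts trivially on `K ⊗_k V`;
* `eq_one_of_smul_eq_of_apply_eq_self` — bookkeeping: an element acting trivially on a NON-ZERO `ψ`-eigenvector of a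
  representation over a field is killed by `ψ`.
(Extension of scalars of representations, [SerreLinearRepresentations1977] §12.1; smooth vectors, [BernsteinZelevinsky1976] §2.1.)

## References
* [SerreLinearRepresentations1977] J.-P. Serre, *Linear Representations of Finite Groups*, GTM 42 (1977), §12.1 (extension of
  scalars).
* [BernsteinZelevinsky1976] I. N. Bernstein, A. V. Zelevinsky, *Representations of the group GL(n,F) where F is a
  non-archimedean local field*, Russian Math. Surveys 31:3 (1976), §2.1 (algebraic = smooth representations: every vector is
  fixed by an open subgroup).
-/

set_option autoImplicit false

noncomputable section

namespace Literature.RepresentationTheory.IntertwiningBaseChange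

open TensorProduct

universe u v w x

variable {k : Type u} [CommRing k] (K : Type v) [CommRing K] [Algebra k K]
variable {G : Type w} [Group G] {V : Type x} [AddCommGroup V] [Module k V] (ρ : Representation k G V)

/-- **Finite-index stabilisers survive extension of scalars**: if every `y ∈ V` is fixed by a finite-index subgroup of `G`
under `ρ`, then every `v ∈ K ⊗_k V` is fixed by a finite-index subgroup under `ρ_K = 1 ⊗ ρ`.
[cite: SerreLinearRepresentations1977, §12.1 (extension of scalars)] -/
theorem exists_finiteIndex_forall_repBaseChange_eq
    (h : ∀ y : V, ∃ N : Subgroup G, N.FiniteIndex ∧ ∀ n ∈ N, ρ n y = y) (v : K ⊗[k] V) :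
    ∃ N : Subgroup G, N.FiniteIndex ∧ ∀ n ∈ N, repBaseChange K ρ n v = v := by
  induction v using TensorProduct.induction_on with
  | zero => exact ⟨⊤, inferInstance, fun n _ => map_zero _⟩
  | tmul c y =>
    obtain ⟨N, hN, hy⟩ := h y
    exact ⟨N, hN, fun n hn => by rw [repBaseChange_apply, LinearMap.baseChange_tmul, hy n hn]⟩
  | add v w hv hw =>
    obtain ⟨N₁, hN₁, h₁⟩ := hv
    obtain ⟨N₂, hN₂, h₂⟩ := hw
    haveI := hN₁
    haveI := hN₂
    exact ⟨N₁ ⊓ N₂, inferInstance, fun n hn => by rw [map_add, h₁ n hn.1, h₂ n hn.2]⟩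

/-- **Open stabilisers survive extension of scalars** (smoothness of `K ⊗_k V`): if every `y ∈ V` is fixed by an open subgroup
of `G` under `ρ`, then every `v ∈ K ⊗_k V` is fixed by an open subgroup under `ρ_K = 1 ⊗ ρ`.
[cite: BernsteinZelevinsky1976, §2.1] [cite: SerreLinearRepresentations1977, §12.1 (extension of scalars)] -/
theorem exists_isOpen_forall_repBaseChange_eq [TopologicalSpace G]
    (h : ∀ y : V, ∃ U : Subgroup G, IsOpen (U : Set G) ∧ ∀ n ∈ U, ρ n y = y) (v : K ⊗[k] V) :
    ∃ U : Subgroup G, IsOpen (U : Set G) ∧ ∀ n ∈ U, repBaseChange K ρ n v = v := by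
  induction v using TensorProduct.induction_on with
  | zero => exact ⟨⊤, isOpen_univ, fun n _ => map_zero _⟩
  | tmul c y =>
    obtain ⟨U, hU, hy⟩ := h y
    exact ⟨U, hU, fun n hn => by rw [repBaseChange_apply, LinearMap.baseChange_tmul, hy n hn]⟩
  | add v w hv hw =>
    obtain ⟨U₁, hU₁, h₁⟩ := hv
    obtain ⟨U₂, hU₂, h₂⟩ := hw
    exact ⟨U₁ ⊓ U₂, hU₁.inter hU₂, fun n hn => by rw [map_add, h₁ n hn.1, h₂ n hn.2]⟩

/-- **An element acting trivially on `V` acts trivially on `K ⊗_k V`.** [cite: SerreLinearRepresentations1977, §12.1 (extension of scalars)] -/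
theorem repBaseChange_eq_self_of_forall_eq_self {g : G} (h : ∀ y : V, ρ g y = y) (v : K ⊗[k] V) :
    repBaseChange K ρ g v = v := by
  induction v using TensorProduct.induction_on with
  | zero => exact map_zero _
  | tmul c y => rw [repBaseChange_apply, LinearMap.baseChange_tmul, h y]
  | add v w hv hw => rw [map_add, hv, hw]

omit [Algebra k K] in
/-- **An element acting trivially on a non-zero `ψ`-eigenvector is killed by `ψ`** (over a field `K`: `ψ u • w = w`, `w ≠ 0`
forces `ψ u = 1`). [cite: SerreLinearRepresentations1977, §12.1 (extension of scalars)] -/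
theorem eq_one_of_smul_eq_of_apply_eq_self {K' : Type*} [Field K'] {W : Type*} [AddCommGroup W] [Module K' W]
    (σ : Representation K' G W) (ψ : G →* K'ˣ) {w : W} (hw0 : w ≠ 0) (hw : ∀ u, σ u w = ((ψ u : K'ˣ) : K') • w)
    {u : G} (hu : σ u w = w) : ψ u = 1 := by
  have h3 : ((ψ u : K'ˣ) : K') • w = (1 : K') • w := by rw [one_smul, ← hw u, hu]
  exact Units.ext (smul_left_injective K' hw0 h3)

end Literature.RepresentationTheory.IntertwiningBaseChange

end
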